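import Summits.QuantumFields.YangMills.Theorems.BalabanUVNodesK0Stub1FlatAveragingDictionaryLevels
import Summits.QuantumFields.YangMills.Theorems.BalabanUVNodesN07RecordDomainsAdm22
import Summits.QuantumFields.YangMills.Theorems.BalabanUVNodesN07RecordDomainsCollar

/-!
# K0⁷ STUB 1 (`stub_prop8StepCoP13`), sub-target S4a — **THE MULTI-LEVEL FLAT AVERAGING DICTIONARY AT NODE 00's RECORD**: p617458's dictionary instantiated on the
# RECORD's OWN region family `domainsOfSeq s.Ω k` of a print-separated (2.18) index `s` (dag-n07-e 44C `Node00/DomainsOfSeq`, collar by dag-n07-w6's FLOOR-FREE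
# `N07RecordDomainsCollar.collar_domainsOfSeq_seqOfRecord`, any `M₁ ≥ 1` — the record's `M₁ = 1` closures included): the skew kernel of print's straight averages on the bonds MEETING `Γ_j(s.Ω)` (the record's fibre index set
# `bondsOf (genSet s.Ω k j)`, B15 reading (b)) is carried into the kernel of the record's linearised averaging `Q_j(1)` on the SAME bonds by ONE 𝔰𝔲(N)-valued gauge function

Cell `pub-ymgap`, width seat `pub-ymgap-k0-s1-w1` g5 (CLAIM-3 ∕ INTENT-4 I.34982 + AMEND I.34999; trigger (t2) of HANDOFF § g5, fired by dag-n07-w6 g0 LANDED-9∕10 p618589 · p620829).  `--kind proof --supports stmt-QuantumFields-20541 --as helper`;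
count-neutral.  [15] = [Balaban1985Variational]; [B6] = [Balaban1984PropagatorsII]; [III] = [Balaban1988Convergent].

WHAT IS PROVED (sorry-free; no definition; axioms standard).  For `F : T4Family`, a (2.18) index `s : SeqOfRecord F ν M g K k` (`k ≤ m + K`) with `Sect2.SeqSeparated M₁ s`, `1 ≤ M₁`
(NO `Adm22`, NO floor; the reading-(b) edition also takes the grid numerics `dCubeSide L M R_j j ∣ sitesPerDir 0` of p618589's `inOm_domainsOfSeq_seqOfRecord_iff` and `1 ≤ k`):
* ★★★ `exists_gauge_dIterL_one_eq_zero_of_bondAvgIter_eq_zero_genSet_seqOfRecord` (INTERIM edition, today's reading (b) of the record's fibre): `Z` skew with `Q_jZ(c) = 0` at every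
  `c ∈ bondsOf (genSet s.Ω k j)`, all `j` ⇒ ONE skew gauge function `ν` (𝔰𝔲(N)-valued if `Z` is) with `Q_j(1)(Z + ∂ν)(c) = 0` at every such `c` — i.e. `Z + ∂ν` is a multi-scale fibre
  tangent of the record (dag-n07-w1 `fderiv_msChart_apply_eq_zero_iff` at `U = 1`).
* ★★ `exists_gauge_dIterL_one_eq_zero_of_constr_zero_seqOfRecord` (PERMANENT edition, [B6] (2.3) `LamBond` of `domainsOfSeq s.Ω k`; in `s.Ω` letters by 44C v1.1 `lamBond_domainsOfSeq_iff`).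
* ★★ `exists_linear_gauge_seqOfRecord` — the linear `T`-edition (p617458's seven clauses) at `D := domainsOfSeq s.Ω k hk` with the collar discharged.
HONEST SCOPE.  Instantiation by name (p617458 + p618589 + p620829); no estimate; the separation `Sect2.SeqSeparated M₁ s` and the grid numerics DISPLAYED; `stub_prop8StepCoP13` ∕ K0⁷ NOT closed;
N07 NOT discharged; counts unmoved (28∕28 · 5∕27); one finite 𝕋⁴ programme at fixed ε — R4 closes the conditional finite-𝕋⁴ rung `BalabanLadder.UV` only, never the summit; the YM mass
gap (Clay) is NOT proved by any of this; nothing continuum ∕ ℝ⁴ ∕ OS.  No `sorry`, no `def`, no `instance`, no `notation`.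

References: [15] (44)–(47) p.285, (150) p.301; [B6] (2.1)–(2.4) p.224, (2.20) p.226; [III] (2.1)–(2.2) pp.254–255, (2.10) p.256, (2.18) p.257.
-/

set_option autoImplicit false
noncomputable section
open scoped BigOperators Matrix Matrix.Norms.L2Operator

namespace Summit.QuantumFields.YangMills.Theorems.K0Stub1FlatAveragingDictionaryLevelsAtRecord

open Literature.MathematicalPhysics.QuantumFieldTheory.Balaban1983to89
open Literature.MathematicalPhysics.QuantumFieldTheory.Balaban1983to89.Node00
open T4Continuum (T4Family)
open LatticeFieldCalculus (bondAvgIter)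
open BlockAveragingEMLLinearised (combMean)
open B15DeterminingSets (embIter genSet bondsOf)
open T4AdjointCovarianceUnitary (lieSU)
open B6SectADomainsV1 (Domains)
open Summit.QuantumFields.YangMills.Theorems.K0Stub1FlatAveragingDictionaryLevels (exists_gauge_dIterL_one_eq_zero_of_bondAvgIter_eq_zero_genSet_of_agree
  exists_gauge_dIterL_one_eq_zero_of_constr_zero exists_linear_gauge_dIterL_one_eq_zero_of_bondAvgIter_eq_zero lamSite_or_of_lamBond)
open Summit.QuantumFields.YangMills.BalabanUVNodes.N07RecordDomainsAdm22 (inOm_domainsOfSeq_seqOfRecord_iff)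
open Summit.QuantumFields.YangMills.BalabanUVNodes.N07RecordDomainsCollar (collar_domainsOfSeq_seqOfRecord)

variable {N : ℕ} [NeZero N] (F : T4Family)

/-- ★★★ **THE DICTIONARY ON THE RECORD's FIBRE INDEX SET (reading (b), interim)** — collar from one-layer separation, any `M₁ ≥ 1`.  [cite: Balaban1988Convergent, (2.2) p.255, (2.10) p.256; Balaban1985Variational, (44)-(47) p.285; Balaban1984PropagatorsII, (2.1)-(2.2) p.224] -/
theorem exists_gauge_dIterL_one_eq_zero_of_bondAvgIter_eq_zero_genSet_seqOfRecord (ν : Stage7Numerics) (M : ℕ) (g : ℕ → ℝ) (K k : ℕ)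
    (hk : k ≤ (F.P K).m + (F.P K).K) (hk1 : 1 ≤ k) (s : SeqOfRecord F ν M g K k) {M₁ : ℕ} (hM₁ : 1 ≤ M₁) (hsep : Sect2.SeqSeparated M₁ s)
    (hdiv : ∀ j : ℕ, 1 ≤ j → j ≤ k → dCubeSide (F.P K).L M (RkOfRecord (F.P K).L ν.r (g j)) j ∣ (F.P K).sitesPerDir 0)
    {Z : PBond (F.P K) 0 → Matrix (Fin N) (Fin N) ℂ} (hZ : ∀ b, star (Z b) = -Z b)
    (h0 : ∀ (j : ℕ), ∀ c ∈ bondsOf (genSet s.Ω k j), bondAvgIter j Z c = 0) :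
    ∃ nu : Site (F.P K) 0 → Matrix (Fin N) (Fin N) ℂ,
      (∀ x, star (nu x) = -nu x) ∧
      (∀ (j : ℕ), ∀ c ∈ bondsOf (genSet s.Ω k j),
        dIterL j (1 : PBond (F.P K) 0 → Matrix (Fin N) (Fin N) ℂ) (fun b => Z b + (nu b.tgt - nu b.src)) c = 0) ∧
      ((∀ b, Z b ∈ lieSU (Fin N)) → ∀ x, nu x ∈ lieSU (Fin N)) := by
  have hΩ : ∀ i, 1 ≤ i → i ≤ (domainsOfSeq s.Ω k hk).k → s.Ω i = {x : Site (F.P K) 0 | (domainsOfSeq s.Ω k hk).InOm i x} := fun i h1 hi =>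
    Set.ext fun x => (inOm_domainsOfSeq_seqOfRecord_iff F ν M g K k hk s hdiv h1 hi x).symm
  exact exists_gauge_dIterL_one_eq_zero_of_bondAvgIter_eq_zero_genSet_of_agree (domainsOfSeq s.Ω k hk)
    (collar_domainsOfSeq_seqOfRecord F ν M g K k hk s hM₁ hsep) hk1 hΩ hZ h0

/-- ★★ **THE DICTIONARY ON [B6] (2.3)'s `Λ_j`-BONDS OF THE RECORD FAMILY (permanent).** [cite: Balaban1984PropagatorsII, (2.1)-(2.3) p.224, (2.20) p.226; Balaban1985Variational, (44)-(47) p.285] -/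
theorem exists_gauge_dIterL_one_eq_zero_of_constr_zero_seqOfRecord (ν : Stage7Numerics) (M : ℕ) (g : ℕ → ℝ) (K k : ℕ)
    (hk : k ≤ (F.P K).m + (F.P K).K) (s : SeqOfRecord F ν M g K k) {M₁ : ℕ} (hM₁ : 1 ≤ M₁) (hsep : Sect2.SeqSeparated M₁ s)
    {Z : PBond (F.P K) 0 → Matrix (Fin N) (Fin N) ℂ} (hZ : ∀ b, star (Z b) = -Z b)
    (h0 : ∀ (j : ℕ) (c : PBond (F.P K) j), (domainsOfSeq s.Ω k hk).LamBond j c → bondAvgIter j Z c = 0) :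
    ∃ nu : Site (F.P K) 0 → Matrix (Fin N) (Fin N) ℂ,
      (∀ x, star (nu x) = -nu x) ∧
      (∀ (j : ℕ) (c : PBond (F.P K) j), (domainsOfSeq s.Ω k hk).LamBond j c →
        dIterL j (1 : PBond (F.P K) 0 → Matrix (Fin N) (Fin N) ℂ) (fun b => Z b + (nu b.tgt - nu b.src)) c = 0) ∧
      ((∀ b, Z b ∈ lieSU (Fin N)) → ∀ x, nu x ∈ lieSU (Fin N)) :=
  exists_gauge_dIterL_one_eq_zero_of_constr_zero (domainsOfSeq s.Ω k hk) (collar_domainsOfSeq_seqOfRecord F ν M g K k hk s hM₁ hsep) hZ h0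

/-- ★★ **THE LINEAR GAUGE MAP `T` OF THE RECORD FAMILY** (p617458's `exists_linear_gauge_dIterL_one_eq_zero_of_bondAvgIter_eq_zero` at `D := domainsOfSeq s.Ω k`, reading (2.3), collar
discharged): seven clauses verbatim. [cite: Balaban1985Variational, (44)-(47) p.285; Balaban1984PropagatorsII, (2.1)-(2.3) p.224, (2.20) p.226; Balaban1985Averaging, (62) p.28] -/
theorem exists_linear_gauge_seqOfRecord (ν : Stage7Numerics) (M : ℕ) (g : ℕ → ℝ) (K k : ℕ)
    (hk : k ≤ (F.P K).m + (F.P K).K) (s : SeqOfRecord F ν M g K k) {M₁ : ℕ} (hM₁ : 1 ≤ M₁) (hsep : Sect2.SeqSeparated M₁ s) :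
    ∃ T : (PBond (F.P K) 0 → Matrix (Fin N) (Fin N) ℂ) →ₗ[ℂ] (Site (F.P K) 0 → Matrix (Fin N) (Fin N) ℂ),
      (∀ Z : PBond (F.P K) 0 → Matrix (Fin N) (Fin N) ℂ, (∀ b, star (Z b) = -Z b) → ∀ x, star (T Z x) = -T Z x) ∧
      (∀ Z : PBond (F.P K) 0 → Matrix (Fin N) (Fin N) ℂ, (∀ b, Z b ∈ lieSU (Fin N)) → ∀ x, T Z x ∈ lieSU (Fin N)) ∧
      (∀ (Z : PBond (F.P K) 0 → Matrix (Fin N) (Fin N) ℂ) (x : Site (F.P K) 0),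
        (¬ ∃ (j : ℕ) (b : PBond (F.P K) j) (y : Site (F.P K) j), (domainsOfSeq s.Ω k hk).LamBond j b ∧ (y = b.src ∨ y = b.tgt) ∧ embIter j y = x) → T Z x = 0) ∧
      (∀ (Λ : (i : ℕ) → (PBond (F.P K) 0 → Matrix (Fin N) (Fin N) ℂ) → Site (F.P K) i → Matrix (Fin N) (Fin N) ℂ),
        (∀ Y y, Λ 0 Y y = 0) →
        (∀ (i : ℕ) (Y : PBond (F.P K) 0 → Matrix (Fin N) (Fin N) ℂ) (y : Site (F.P K) (i + 1)),
          Λ (i + 1) Y y = ((F.P K).L ^ i : ℕ) • combMean (bondAvgIter i Y) y + Λ i Y (emb y)) →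
        ∀ Z : PBond (F.P K) 0 → Matrix (Fin N) (Fin N) ℂ, (∀ (j : ℕ) (c : PBond (F.P K) j), (domainsOfSeq s.Ω k hk).LamBond j c → bondAvgIter j Z c = 0) →
          ∀ (j : ℕ) (b : PBond (F.P K) j) (y : Site (F.P K) j), (domainsOfSeq s.Ω k hk).LamBond j b → (y = b.src ∨ y = b.tgt) → T Z (embIter j y) = Λ j Z y) ∧
      (∀ (Λ : (i : ℕ) → (PBond (F.P K) 0 → Matrix (Fin N) (Fin N) ℂ) → Site (F.P K) i → Matrix (Fin N) (Fin N) ℂ),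
        (∀ Y y, Λ 0 Y y = 0) →
        (∀ (i : ℕ) (Y : PBond (F.P K) 0 → Matrix (Fin N) (Fin N) ℂ) (y : Site (F.P K) (i + 1)),
          Λ (i + 1) Y y = ((F.P K).L ^ i : ℕ) • combMean (bondAvgIter i Y) y + Λ i Y (emb y)) →
        ∀ (Z : PBond (F.P K) 0 → Matrix (Fin N) (Fin N) ℂ) (x : Site (F.P K) 0), T Z x = 0 ∨
          ∃ (j : ℕ) (b : PBond (F.P K) j) (y : Site (F.P K) j), (domainsOfSeq s.Ω k hk).LamBond j b ∧ (y = b.src ∨ y = b.tgt) ∧ embIter j y = x ∧ T Z x = Λ j Z y) ∧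
      (∀ (Z : PBond (F.P K) 0 → Matrix (Fin N) (Fin N) ℂ) (t : ℝ), 0 ≤ t → (∀ b, ‖Z b‖ ≤ t) →
        ∀ x, ‖T Z x‖ ≤ (((F.P K).d + 2 : ℕ) : ℝ) * ((F.P K).L : ℝ) ^ (k + 1) * t) ∧
      (∀ Z : PBond (F.P K) 0 → Matrix (Fin N) (Fin N) ℂ, (∀ b, star (Z b) = -Z b) →
        (∀ (j : ℕ) (c : PBond (F.P K) j), (domainsOfSeq s.Ω k hk).LamBond j c → bondAvgIter j Z c = 0) →
        ∀ (j : ℕ) (c : PBond (F.P K) j), (domainsOfSeq s.Ω k hk).LamBond j c →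
          dIterL j (1 : PBond (F.P K) 0 → Matrix (Fin N) (Fin N) ℂ) (fun b => Z b + (T Z b.tgt - T Z b.src)) c = 0) :=
  exists_linear_gauge_dIterL_one_eq_zero_of_bondAvgIter_eq_zero (domainsOfSeq s.Ω k hk) (collar_domainsOfSeq_seqOfRecord F ν M g K k hk s hM₁ hsep)
    (fun j b => (domainsOfSeq s.Ω k hk).LamBond j b) (fun _ _ hb => lamSite_or_of_lamBond (domainsOfSeq s.Ω k hk) hb)
    (fun _ _ hs ht => ⟨Or.inl hs.1, hs.2, ht.2⟩)

end Summit.QuantumFields.YangMills.Theorems.K0Stub1FlatAveragingDictionaryLevelsAtRecord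

end
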